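import Summits.HodgeConjecture.HodgeConjecture.Theorems.F0P3cStCharTSOpenCellFactorisationThree   -- ★ T4 «OPEN-CELL FACTORISATION FOR Φ₃» (F0P2-p06): `w₀ n(a,b) = U · L` as a polynomial identity
import Summits.HodgeConjecture.HodgeConjecture.Theorems.F0P2oBorelTorusModulus                   -- ★ `rootDeltaChar_cmBorel_eq_unitModulusChar` (`δ_B^{1/2}(p) = ‖p₀₀‖`); brings ★ `HeisRing.distribHaarChar_map_eq` (`‖σ b‖ = ‖b‖`)
import Literature.NumberTheory.Automorphic.CMPrincipalSeriesSpherical                            -- ★ `coe_torusEntry_proj_borelTriple` ∕ `val_proj_borelTriple` (`proj p = diag(p_ii)`)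
import Literature.NumberTheory.Automorphic.HeisenbergChartAtNonsplitPlace                        -- ★ `HeisRing.heisElt` chart + `umat_one_two` ∕ `umat_zero_two_add_map` (closure); `isUnit_two_localRing`
import Literature.NumberTheory.Automorphic.UnitaryGroupPrincipalSeriesExponents                 -- ★ `cmTorusCharPair` (the PAIR currency `χ = (χ₁, χ₂)` of RUNG 0)
import HarnessLib

/-!
# F0 · P3c · line LH6 «StCharTS» — «BIG-CELL FACTORISATION INSIDE `U(Φ₃)`★»: ★ T4's identity `w₀ · u = U · L` realised in the GROUP, and the EXACT value of the
# cell function `f(w₀ u) = χ₁(σ b)⁻¹ · χ₂(−1) · ‖b‖⁻¹ · f(L)` of every vector `f ∈ i_G(χ₁, χ₂)` [Rogawski1990 §1.10, §12.1; Casselman1995 Prop. 1.3.3]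

Cell `pub/hodgecm-mathlib`, crux H413 = `stmt-HodgeConjecture-24833` (lane `--supports … --as helper`), route HCCMUnconditional; seat LH6-p04 (g10), twin of the
ROAD «KEYS3-ANALYTIC» holder F0P2-p06 (g21) (LEAD F0P3a-plan T15-03 (b); deal 2026-09-02T23:20:46Z, sigsheet «=» 23:30:46Z): FILE 1 of 2 of brick **B4** «CELL FUNCTION FAR OUT★»
of MEMO `F0/P2/F0P2-p06/g21/MEMO-KEYS3-analytic-road.v3` §1∕§4 (FILE 2 = `F0P3cStCharTSCellFunFarOut`: the far-out limit and the HEAD).  THEOREMS ONLY (0 def ∕ 0 instance ∕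
0 notation ∕ 0 sorry); ★-only imports.

WHAT.  `R` a commutative ring with involution `σ`, `G = U(σ, Φ₃)(R)`, `B = TN` its Borel subgroup, `w₀ ∈ G` the element of matrix `Φ₃`, `u ∈ N` with entries `a = u₀₁`, `b = u₀₂`
(`b + σb + aσa = 0`).  When `b` is a unit, ★ T4's polynomial identity `w₀ · u = U · L` is realised INSIDE `G`:
* §1 (generic algebra; `2 ∈ Rˣ` only for the existence of `u′`) `L = w₀ u′ w₀⁻¹` with `u′ ∈ N` the element of entries `(a b⁻¹, b⁻¹)` (**`exists_unipotentU_entries_eq`**, unique by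
  `unipotentU_eq_of_entries_eq`; its matrix `val_weylConj_unipotent_eq`), and `U := w₀ u L⁻¹` has the matrix of T4's upper factor (**`val_upperFactor_eq`**), so `U ∈ B`
  (**`weylElt_mul_unipotent_mul_inv_mem_borelU`**) with `U₀₀ = σ(b)⁻¹` (`coe_diagEntry_zero_upperFactor`) and `det U = −1` (`det_upperFactor`).
* §2 (`R = ∏_{w ∣ v} L_w`, `σ = c ⊗ 1`, `J = cmLocalForm L 3 v`) for EVERY `f` in the carrier of ★ `cmPrincipalSeries L 3 v (cmTorusCharPair L v χ₁ χ₂)` and every unit `b`: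
  **`toFun_weylElt_mul_eq_of_isUnit`**: `f(w₀ u) = χ₁(σ b)⁻¹ · χ₂(−1) · ‖b‖⁻¹ · f(w₀ u′ w₀⁻¹)` — `f(U g) = χ(proj U) δ_B^{1/2}(U) f(g)`, `χ(proj U) = χ₁(U₀₀) χ₂(det U)` (★
  `coe_torusEntry_proj_borelTriple`, `val_proj_borelTriple`), `δ_B^{1/2}(U) = ‖U₀₀‖` (★ `rootDeltaChar_cmBorel_eq_unitModulusChar`), `‖σ(b⁻¹)‖ = ‖b‖⁻¹` (★ `HeisRing.distribHaarChar_map_eq`).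
WHY (MEMO v3 §1): the closed form of the cell function `F(n) = f₀(w₀ n)` on the big cell is the integrand of the annulus formula `Λ(g₀(m)) = ± χ(m) ∫_{shell} F` of the in-house
road to RUNG 0's outer input `hKeysRed3` (Keys' reducibility theorem, case (3) [Keys1984 §7 Thm. (1); Rogawski1990 §12.2 (3)]); FILE 2 removes `f(L)` far out (`L → 1`).
HONEST LABEL: HC_CM is proved only modulo the 7 printed citations (2 remaining named inputs: hLiu418 = `stmt-HodgeConjecture-24832`, h413 = `stmt-HodgeConjecture-24833`) until
rung 0 closes; count-neutral organ-level computation (no node closes here).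

## References
* [Rogawski1990] J. D. Rogawski, *Automorphic Representations of Unitary Groups in Three Variables*, Ann. of Math. Stud. 123 (1990), §1.10 p. 9 (`B = TN`, `w`, `N = {u(x,z)}`),
  §12.1 p. 171 (`χ = (χ₁, χ₂)`, `i_G(χ)`), §12.2 (3) p. 174.
* [Casselman1995] W. Casselman, *Introduction to the theory of admissible representations of p-adic reductive groups* (1995), Prop. 1.3.3 (`PwP = P w N_w`, the big cell).
* [Keys1984] D. Keys, *Principal series representations of special unitary groups over local fields*, Compositio Math. 51 (1984), §7 Thm. (1) p. 126.
-/

set_option autoImplicit false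
-- the mandated namespace has the single-problem summit's repeated segment (`HodgeConjecture.HodgeConjecture`)
set_option linter.dupNamespace false

noncomputable section

open NumberField IsDedekindDomain MeasureTheory
open scoped Matrix MatrixGroups NNReal
open Literature.NumberTheory.Automorphic Literature.NumberTheory.Automorphic.UnitaryGroup
open Summit.HodgeConjecture.HodgeConjecture.Cruxes.H413.F0P3cStCharTSOpenCellFactorisationThree

namespace Summit.HodgeConjecture.HodgeConjecture.Cruxes.H413.F0P3cStCharTSBigCellFactorisation

/-! ## §1 Generic ring `R` with involution `σ`, `J = Φ₃`, `w₀` of matrix `Φ₃`: ★ T4's factorisation `w₀ u = U · (w₀ u′ w₀⁻¹)` INSIDE `G` -/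

section Generic

variable {R : Type*} [CommRing R] (σ : R →+* R) (hσ : ∀ x, σ (σ x) = x)
  {J : Matrix (Fin 3) (Fin 3) R} (hJ : J = (StdForm.antidiagonal 3).over R)
  (w₀ : ↥(unitaryGroupOfForm σ J)) (hw₀ : ((w₀ : GL (Fin 3) R) : Matrix (Fin 3) (Fin 3) R) = J)

/-- `−1 ∈ E¹`: `σ(−1) · (−1) = 1` — the value `det U = −1` of the upper factor is read by `χ₂ ∈ Hom(E¹, ℂ×)`. [cite: Rogawski1990, §12.1 p. 171] -/
theorem neg_one_mem_normOneUnits : (-1 : Rˣ) ∈ normOneUnits σ := by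
  rw [mem_normOneUnits_iff, Units.val_neg, Units.val_one, map_neg, map_one, neg_mul_neg, one_mul]

include hJ in
/-- **The matrix of `u ∈ N`** is `[[1, a, b],[0, 1, −σa],[0, 0, 1]]` with `a = u₀₁`, `b = u₀₂` (unitriangular shape + the `(1,2)` unitarity relation ★ `HeisRing.umat_one_two`).
[cite: Rogawski1990, §1.10 p. 9] -/
theorem val_coe_unipotentU_eq (u : ↥(unipotentU σ J)) :
    ((u : ↥(unitaryGroupOfForm σ J)) : GL (Fin 3) R).val =
      !![1, (((u : ↥(unitaryGroupOfForm σ J)) : GL (Fin 3) R) : Matrix (Fin 3) (Fin 3) R) 0 1,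
          (((u : ↥(unitaryGroupOfForm σ J)) : GL (Fin 3) R) : Matrix (Fin 3) (Fin 3) R) 0 2;
        0, 1, -σ ((((u : ↥(unitaryGroupOfForm σ J)) : GL (Fin 3) R) : Matrix (Fin 3) (Fin 3) R) 0 1);
        0, 0, 1] := by
  obtain ⟨htri, hdiag⟩ := (mem_unipotentU_iff (u : ↥(unitaryGroupOfForm σ J))).1 u.2
  have h12 := HeisRing.umat_one_two σ hJ u
  ext i j
  fin_cases i <;> fin_cases j
  · exact hdiag 0
  · rfl
  · rfl
  · exact htri (by decide)
  · exact hdiag 1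
  · exact h12
  · exact htri (by decide)
  · exact htri (by decide)
  · exact hdiag 2

include hJ in
/-- **An element of `N` is determined by its entries `(u₀₁, u₀₂)`.** [cite: Rogawski1990, §1.10 p. 9] -/
theorem unipotentU_eq_of_entries_eq (u u' : ↥(unipotentU σ J))
    (h1 : (((u : ↥(unitaryGroupOfForm σ J)) : GL (Fin 3) R) : Matrix (Fin 3) (Fin 3) R) 0 1 =
      (((u' : ↥(unitaryGroupOfForm σ J)) : GL (Fin 3) R) : Matrix (Fin 3) (Fin 3) R) 0 1)
    (h2 : (((u : ↥(unitaryGroupOfForm σ J)) : GL (Fin 3) R) : Matrix (Fin 3) (Fin 3) R) 0 2 =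
      (((u' : ↥(unitaryGroupOfForm σ J)) : GL (Fin 3) R) : Matrix (Fin 3) (Fin 3) R) 0 2) : u = u' := by
  refine Subtype.ext (Subtype.ext (Units.ext ?_))
  rw [val_coe_unipotentU_eq σ hJ u, val_coe_unipotentU_eq σ hJ u', h1, h2]

include hJ hw₀ in
/-- The matrix of `w₀` is `Φ₃ = antidiag(1, 1, 1)` as an explicit `3 × 3` matrix. [cite: Rogawski1990, §1.10 p. 9] -/
theorem val_weylElt_eq : ((w₀ : GL (Fin 3) R) : Matrix (Fin 3) (Fin 3) R) = !![0, 0, 1; 0, 1, 0; 1, 0, 0] := by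
  rw [hw₀, hJ]
  ext i j
  simp only [StdForm.over, StdForm.antidiagonal, Matrix.map_apply, Matrix.of_apply]
  fin_cases i <;> fin_cases j <;> simp [Fin.ext_iff]

include hJ hw₀ in
/-- **The matrix of `w₀ u′ w₀⁻¹ ∈ N̄ = w₀ N w₀⁻¹`** is lower unitriangular: `[[1, 0, 0],[−σ u′₀₁, 1, 0],[u′₀₂, u′₀₁, 1]]` — ★ T4's lower factor `L` when
`(u′₀₁, u′₀₂) = (a b⁻¹, b⁻¹)`. [cite: Casselman1995, Prop. 1.3.3] [cite: Rogawski1990, §1.10 p. 9] -/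
theorem val_weylConj_unipotent_eq (u' : ↥(unipotentU σ J)) :
    ((w₀ * (u' : ↥(unitaryGroupOfForm σ J)) * w₀⁻¹ : ↥(unitaryGroupOfForm σ J)) : GL (Fin 3) R).val =
      !![1, 0, 0;
        -σ ((((u' : ↥(unitaryGroupOfForm σ J)) : GL (Fin 3) R) : Matrix (Fin 3) (Fin 3) R) 0 1), 1, 0;
        (((u' : ↥(unitaryGroupOfForm σ J)) : GL (Fin 3) R) : Matrix (Fin 3) (Fin 3) R) 0 2,
          (((u' : ↥(unitaryGroupOfForm σ J)) : GL (Fin 3) R) : Matrix (Fin 3) (Fin 3) R) 0 1, 1] := by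
  -- `w₀⁻¹ = w₀` (`Φ₃² = 1`)
  have hinv : w₀⁻¹ = w₀ := by
    refine inv_eq_of_mul_eq_one_right (Subtype.ext (Units.ext ?_))
    rw [Subgroup.coe_mul, Units.val_mul, val_weylElt_eq σ hJ w₀ hw₀, Subgroup.coe_one, Units.val_one]
    ext i j
    fin_cases i <;> fin_cases j <;> simp
  rw [hinv, Subgroup.coe_mul, Subgroup.coe_mul, Units.val_mul, Units.val_mul,
    val_coe_unipotentU_eq σ hJ u', val_weylElt_eq σ hJ w₀ hw₀]
  ext i j
  fin_cases i <;> fin_cases j <;> simp [Matrix.mul_apply, Fin.sum_univ_three]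

include hσ hJ in
/-- **The rescaled element `u′ ∈ N` of entries `(a b⁻¹, b⁻¹)`** exists when `b = u₀₂` is a unit (`2 ∈ Rˣ`; the chart ★ `HeisRing.heisElt` at `x = a b⁻¹`,
`y = b⁻¹ + ½ x σx`, which is skew by the unitarity relation `b + σb + aσa = 0`, ★ `HeisRing.umat_zero_two_add_map`). [cite: Casselman1995, Prop. 1.3.3]
[cite: Rogawski1990, §1.10 p. 9] -/
theorem exists_unipotentU_entries_eq [Invertible (2 : R)] (u : ↥(unipotentU σ J)) (b : Rˣ)
    (hbu : (((u : ↥(unitaryGroupOfForm σ J)) : GL (Fin 3) R) : Matrix (Fin 3) (Fin 3) R) 0 2 = b) :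
    ∃ u' : ↥(unipotentU σ J),
      (((u' : ↥(unitaryGroupOfForm σ J)) : GL (Fin 3) R) : Matrix (Fin 3) (Fin 3) R) 0 1 =
          (((u : ↥(unitaryGroupOfForm σ J)) : GL (Fin 3) R) : Matrix (Fin 3) (Fin 3) R) 0 1 * ↑b⁻¹ ∧
        (((u' : ↥(unitaryGroupOfForm σ J)) : GL (Fin 3) R) : Matrix (Fin 3) (Fin 3) R) 0 2 = ↑b⁻¹ := by
  -- names: `a = u₀₁`, `b = u₀₂`, `bi = b⁻¹`
  set a : R := (((u : ↥(unitaryGroupOfForm σ J)) : GL (Fin 3) R) : Matrix (Fin 3) (Fin 3) R) 0 1 with ha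
  set bi : R := ↑b⁻¹ with hbi
  have hbbi : (b : R) * bi = 1 := b.mul_inv
  have hb' : σ b * σ bi = 1 := by rw [← map_mul, hbbi, map_one]
  have hrel : (b : R) + σ b + a * σ a = 0 := by
    have h := HeisRing.umat_zero_two_add_map σ hσ hJ u
    rw [← ha, hbu] at h
    linear_combination h
  -- the skew coordinate `y' = bi + ½ x' σx'`, `x' = a bi`
  have hy : bi + ⅟(2 : R) * (a * bi * σ (a * bi)) ∈ HeisRing.skewPart σ := by
    have hσP : σ (a * bi * σ (a * bi)) = a * bi * σ (a * bi) := by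
      rw [map_mul σ (a * bi) (σ (a * bi)), hσ, mul_comm]
    rw [HeisRing.mem_skewPart_iff, map_add, map_mul σ ⅟(2 : R) (a * bi * σ (a * bi)), HeisRing.map_invOf_two σ, hσP,
      map_mul σ a bi]
    have key : σ bi + bi + a * bi * (σ a * σ bi) = 0 := by
      linear_combination (bi * σ bi) * hrel - σ bi * hbbi - bi * hb'
    have h22 : (⅟(2 : R) + ⅟(2 : R) : R) = 1 := invOf_two_add_invOf_two
    linear_combination key + (a * bi * (σ a * σ bi)) * h22
  refine ⟨HeisRing.heisElt σ hσ hJ (a * bi) ⟨_, hy⟩, ?_, ?_⟩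
  · exact HeisRing.heisX_heisElt σ hσ hJ (a * bi) ⟨_, hy⟩
  · change (HeisRing.heisGL σ hσ (a * bi) ⟨_, hy⟩ : Matrix (Fin 3) (Fin 3) R) 0 2 = bi
    simp only [HeisRing.coe_heisGL, HeisRing.heisMatrix, HeisRing.heisZ, Matrix.of_apply, Matrix.cons_val', Matrix.cons_val_zero,
      Matrix.cons_val_two, Matrix.empty_val', Matrix.cons_val_fin_one, Matrix.tail_cons, Matrix.head_cons]
    ring

include hσ hJ hw₀ in
/-- **★ T4 INSIDE `G` — the matrix of the upper factor `U := w₀ · u · (w₀ u′ w₀⁻¹)⁻¹`** is `[[σ(b⁻¹), −a b⁻¹, 1],[0, −σb · b⁻¹, −σa],[0, 0, b]]`: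
`(w₀ u) · L⁻¹ = (U · L) · L⁻¹` by ★ `antidiagonal_mul_unipotent_eq_upper_mul_lower` (with `a′ = σa`, `b′ = σb`, `bi = b⁻¹`, `b′i = σ(b⁻¹)`) and `det L = 1`.
[cite: Casselman1995, Prop. 1.3.3] [cite: Rogawski1990, §1.10 p. 9] -/
theorem val_upperFactor_eq (u u' : ↥(unipotentU σ J)) (b : Rˣ)
    (hbu : (((u : ↥(unitaryGroupOfForm σ J)) : GL (Fin 3) R) : Matrix (Fin 3) (Fin 3) R) 0 2 = b)
    (h1 : (((u' : ↥(unitaryGroupOfForm σ J)) : GL (Fin 3) R) : Matrix (Fin 3) (Fin 3) R) 0 1 =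
      (((u : ↥(unitaryGroupOfForm σ J)) : GL (Fin 3) R) : Matrix (Fin 3) (Fin 3) R) 0 1 * ↑b⁻¹)
    (h2 : (((u' : ↥(unitaryGroupOfForm σ J)) : GL (Fin 3) R) : Matrix (Fin 3) (Fin 3) R) 0 2 = ↑b⁻¹) :
    ((w₀ * (u : ↥(unitaryGroupOfForm σ J)) * (w₀ * (u' : ↥(unitaryGroupOfForm σ J)) * w₀⁻¹)⁻¹ : ↥(unitaryGroupOfForm σ J)) : GL (Fin 3) R).val =
      !![σ (↑b⁻¹ : R), -((((u : ↥(unitaryGroupOfForm σ J)) : GL (Fin 3) R) : Matrix (Fin 3) (Fin 3) R) 0 1 * ↑b⁻¹), 1;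
        0, -(σ b * ↑b⁻¹), -σ ((((u : ↥(unitaryGroupOfForm σ J)) : GL (Fin 3) R) : Matrix (Fin 3) (Fin 3) R) 0 1);
        0, 0, (b : R)] := by
  set a : R := (((u : ↥(unitaryGroupOfForm σ J)) : GL (Fin 3) R) : Matrix (Fin 3) (Fin 3) R) 0 1 with ha
  set bi : R := ↑b⁻¹ with hbi
  have hbbi : (b : R) * bi = 1 := b.mul_inv
  have hb' : σ b * σ bi = 1 := by rw [← map_mul, hbbi, map_one]
  have hrel : (b : R) + σ b + a * σ a = 0 := by
    have h := HeisRing.umat_zero_two_add_map σ hσ hJ u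
    rw [← ha, hbu] at h
    linear_combination h
  -- T4: `W · u = U · L`
  have hT4 := antidiagonal_mul_unipotent_eq_upper_mul_lower a (σ a) (b : R) (σ b) bi (σ bi) hrel hbbi hb'
  -- the lower factor `L = w₀ u' w₀⁻¹`
  have hL : ((w₀ * (u' : ↥(unitaryGroupOfForm σ J)) * w₀⁻¹ : ↥(unitaryGroupOfForm σ J)) : GL (Fin 3) R).val =
      !![1, 0, 0; -(σ a * σ bi), 1, 0; bi, a * bi, 1] := by
    rw [val_weylConj_unipotent_eq σ hJ w₀ hw₀ u', h1, h2, map_mul]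
  have hLdet : (!![1, 0, 0; -(σ a * σ bi), 1, 0; bi, a * bi, 1] : Matrix (Fin 3) (Fin 3) R).det = 1 := by
    rw [Matrix.det_fin_three]; simp
  have hLunit : IsUnit (!![1, 0, 0; -(σ a * σ bi), 1, 0; bi, a * bi, 1] : Matrix (Fin 3) (Fin 3) R).det := by
    rw [hLdet]; exact isUnit_one
  have hu : ((u : ↥(unitaryGroupOfForm σ J)) : GL (Fin 3) R).val = !![1, a, (b : R); 0, 1, -σ a; 0, 0, 1] := by
    rw [val_coe_unipotentU_eq σ hJ u, ← ha, hbu]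
  rw [Subgroup.coe_mul, Subgroup.coe_inv, Units.val_mul, Matrix.coe_units_inv, hL, Subgroup.coe_mul, Units.val_mul,
    val_weylElt_eq σ hJ w₀ hw₀, hu, hT4, Matrix.mul_assoc, Matrix.mul_nonsing_inv _ hLunit, Matrix.mul_one]

include hσ hJ hw₀ in
/-- **`U := w₀ · u · (w₀ u′ w₀⁻¹)⁻¹` lies in the Borel subgroup `B`** (its matrix is upper triangular). [cite: Casselman1995, Prop. 1.3.3] [cite: Rogawski1990, §1.10 p. 9] -/
theorem weylElt_mul_unipotent_mul_inv_mem_borelU (u u' : ↥(unipotentU σ J)) (b : Rˣ)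
    (hbu : (((u : ↥(unitaryGroupOfForm σ J)) : GL (Fin 3) R) : Matrix (Fin 3) (Fin 3) R) 0 2 = b)
    (h1 : (((u' : ↥(unitaryGroupOfForm σ J)) : GL (Fin 3) R) : Matrix (Fin 3) (Fin 3) R) 0 1 =
      (((u : ↥(unitaryGroupOfForm σ J)) : GL (Fin 3) R) : Matrix (Fin 3) (Fin 3) R) 0 1 * ↑b⁻¹)
    (h2 : (((u' : ↥(unitaryGroupOfForm σ J)) : GL (Fin 3) R) : Matrix (Fin 3) (Fin 3) R) 0 2 = ↑b⁻¹) :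
    w₀ * (u : ↥(unitaryGroupOfForm σ J)) * (w₀ * (u' : ↥(unitaryGroupOfForm σ J)) * w₀⁻¹)⁻¹ ∈ borelU σ J := by
  rw [mem_borelU_iff]
  intro i j hij
  change ((w₀ * (u : ↥(unitaryGroupOfForm σ J)) * (w₀ * (u' : ↥(unitaryGroupOfForm σ J)) * w₀⁻¹)⁻¹ : ↥(unitaryGroupOfForm σ J)) : GL (Fin 3) R).val i j = 0
  rw [val_upperFactor_eq σ hσ hJ w₀ hw₀ u u' b hbu h1 h2]
  fin_cases i <;> fin_cases j <;> simp_all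

include hσ hJ hw₀ in
/-- **`U₀₀ = σ(b)⁻¹`** as a unit (★ `diagEntry`, the coordinate read by `χ₁` and by `δ_B^{1/2}`). [cite: Rogawski1990, §1.10 p. 9; §12.1 p. 171] -/
theorem coe_diagEntry_zero_upperFactor (u u' : ↥(unipotentU σ J)) (b : Rˣ)
    (hbu : (((u : ↥(unitaryGroupOfForm σ J)) : GL (Fin 3) R) : Matrix (Fin 3) (Fin 3) R) 0 2 = b)
    (h1 : (((u' : ↥(unitaryGroupOfForm σ J)) : GL (Fin 3) R) : Matrix (Fin 3) (Fin 3) R) 0 1 =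
      (((u : ↥(unitaryGroupOfForm σ J)) : GL (Fin 3) R) : Matrix (Fin 3) (Fin 3) R) 0 1 * ↑b⁻¹)
    (h2 : (((u' : ↥(unitaryGroupOfForm σ J)) : GL (Fin 3) R) : Matrix (Fin 3) (Fin 3) R) 0 2 = ↑b⁻¹)
    (hU : w₀ * (u : ↥(unitaryGroupOfForm σ J)) * (w₀ * (u' : ↥(unitaryGroupOfForm σ J)) * w₀⁻¹)⁻¹ ∈ borelU σ J) :
    diagEntry σ J 0 ⟨_, hU⟩ = (Units.map (σ : R →* R) b)⁻¹ := by
  refine Units.ext ?_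
  rw [coe_diagEntry, Units.coe_map_inv, MonoidHom.coe_coe]
  change ((w₀ * (u : ↥(unitaryGroupOfForm σ J)) * (w₀ * (u' : ↥(unitaryGroupOfForm σ J)) * w₀⁻¹)⁻¹ : ↥(unitaryGroupOfForm σ J)) : GL (Fin 3) R).val 0 0 = _
  rw [val_upperFactor_eq σ hσ hJ w₀ hw₀ u u' b hbu h1 h2]
  rfl

include hσ hJ hw₀ in
/-- **`det U = −1`** (★ `det_upper_factor`), so `χ₂(det U) = χ₂(−1)` is CONSTANT along the big cell. [cite: Rogawski1990, §1.10 p. 9; §12.1 p. 171] -/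
theorem det_upperFactor (u u' : ↥(unipotentU σ J)) (b : Rˣ)
    (hbu : (((u : ↥(unitaryGroupOfForm σ J)) : GL (Fin 3) R) : Matrix (Fin 3) (Fin 3) R) 0 2 = b)
    (h1 : (((u' : ↥(unitaryGroupOfForm σ J)) : GL (Fin 3) R) : Matrix (Fin 3) (Fin 3) R) 0 1 =
      (((u : ↥(unitaryGroupOfForm σ J)) : GL (Fin 3) R) : Matrix (Fin 3) (Fin 3) R) 0 1 * ↑b⁻¹)
    (h2 : (((u' : ↥(unitaryGroupOfForm σ J)) : GL (Fin 3) R) : Matrix (Fin 3) (Fin 3) R) 0 2 = ↑b⁻¹) :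
    (((w₀ * (u : ↥(unitaryGroupOfForm σ J)) * (w₀ * (u' : ↥(unitaryGroupOfForm σ J)) * w₀⁻¹)⁻¹ : ↥(unitaryGroupOfForm σ J)) : GL (Fin 3) R) :
        Matrix (Fin 3) (Fin 3) R).det = -1 := by
  have hbbi : (b : R) * ↑b⁻¹ = 1 := b.mul_inv
  have hb' : σ b * σ ↑b⁻¹ = 1 := by rw [← map_mul, hbbi, map_one]
  change ((w₀ * (u : ↥(unitaryGroupOfForm σ J)) * (w₀ * (u' : ↥(unitaryGroupOfForm σ J)) * w₀⁻¹)⁻¹ : ↥(unitaryGroupOfForm σ J)) : GL (Fin 3) R).val.det = -1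
  rw [val_upperFactor_eq σ hσ hJ w₀ hw₀ u u' b hbu h1 h2]
  exact det_upper_factor _ _ _ _ _ _ hbbi hb'

end Generic

/-! ## §2 The CM instance `R = ∏_{w ∣ v} L_w`, `σ = c ⊗ 1`, `J = cmLocalForm L 3 v`: the EXACT character value on the big cell -/

section CM

variable (L : Type) [Field L] [NumberField L] [IsCMField L] (v : HeightOneSpectrum (𝓞 ↥(maximalRealSubfield L)))
  (χ₁ : (LocalRing L v)ˣ →* ℂˣ) (χ₂ : ↥(normOneUnits (conjLocal L (IsCMField.complexConj L) v)) →* ℂˣ)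
  (w₀ : ↥(unitaryGroupOfForm (conjLocal L (IsCMField.complexConj L) v) (cmLocalForm L 3 v)))
  (hw₀ : Units.val (w₀ : GL (Fin 3) (LocalRing L v)) = cmLocalForm L 3 v)

set_option synthInstance.maxHeartbeats 400000 in
set_option maxHeartbeats 1600000 in
-- statement over the `SmoothInd` carrier of ★ `cmPrincipalSeries` (class of ★ `F0P3U3PrincipalSeriesOpenCellTorusChar`)
include hw₀ in
/-- **THE CELL FUNCTION ON THE BIG CELL, EXACT FORM**: for every `f` in the `SmoothInd` carrier of ★ `cmPrincipalSeries L 3 v (cmTorusCharPair L v χ₁ χ₂)` (`f(p g) = χ(proj p) δ_B^{1/2}(p) f(g)`),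
every `u ∈ N` whose entry `b = u₀₂` is a unit and `u′ ∈ N` the rescaled element of entries `(a b⁻¹, b⁻¹)`:
  `f(w₀ u) = χ₁(σ b)⁻¹ · χ₂(−1) · ‖b‖⁻¹ · f(w₀ u′ w₀⁻¹)`
(`χ(proj U) = χ₁(U₀₀) χ₂(det U)` by ★ `coe_torusEntry_proj_borelTriple` ∕ `val_proj_borelTriple`; `δ_B^{1/2}(U) = ‖U₀₀‖ = ‖σ(b⁻¹)‖ = ‖b‖⁻¹` by ★ `rootDeltaChar_cmBorel_eq_unitModulusChar` and
★ `HeisRing.distribHaarChar_map_eq`). [cite: Rogawski1990, §12.1 p. 171] [cite: Casselman1995, Prop. 1.3.3] -/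
theorem toFun_weylElt_mul_eq_of_isUnit
    (f : haveI := locallyCompactSpace_cmBorelU L 3 v
      Representation.SmoothInd (cmBorelTriple L 3 v).P
        (Representation.twist
          (((Representation.trivial ℂ ↥(torusU (conjLocal L (IsCMField.complexConj L) v) (cmLocalForm L 3 v)) ℂ).twist
            (cmTorusCharPair L v χ₁ χ₂)).comp (cmBorelTriple L 3 v).proj) (rootDeltaChar (cmBorelTriple L 3 v).P)))
    (u u' : ↥(cmBorelTriple L 3 v).N) (b : (LocalRing L v)ˣ)
    (hbu : (((u : ↥(unitaryGroupOfForm (conjLocal L (IsCMField.complexConj L) v) (cmLocalForm L 3 v))) : GL (Fin 3) (LocalRing L v)) :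
      Matrix (Fin 3) (Fin 3) (LocalRing L v)) 0 2 = b)
    (h1 : (((u' : ↥(unitaryGroupOfForm (conjLocal L (IsCMField.complexConj L) v) (cmLocalForm L 3 v))) : GL (Fin 3) (LocalRing L v)) :
        Matrix (Fin 3) (Fin 3) (LocalRing L v)) 0 1 =
      (((u : ↥(unitaryGroupOfForm (conjLocal L (IsCMField.complexConj L) v) (cmLocalForm L 3 v))) : GL (Fin 3) (LocalRing L v)) :
        Matrix (Fin 3) (Fin 3) (LocalRing L v)) 0 1 * ↑b⁻¹)
    (h2 : (((u' : ↥(unitaryGroupOfForm (conjLocal L (IsCMField.complexConj L) v) (cmLocalForm L 3 v))) : GL (Fin 3) (LocalRing L v)) :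
        Matrix (Fin 3) (Fin 3) (LocalRing L v)) 0 2 = ↑b⁻¹) :
    f.toFun (w₀ * (u : ↥(unitaryGroupOfForm (conjLocal L (IsCMField.complexConj L) v) (cmLocalForm L 3 v)))) =
      ((((χ₁ (Units.map (conjLocal L (IsCMField.complexConj L) v : LocalRing L v →* LocalRing L v) b))⁻¹ : ℂˣ) : ℂ) *
          ((χ₂ ⟨-1, neg_one_mem_normOneUnits (conjLocal L (IsCMField.complexConj L) v)⟩ : ℂˣ) : ℂ) *
          ((((unitModulusChar (LocalRing L v) b)⁻¹ : ℝ≥0) : ℝ) : ℂ)) *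
        f.toFun (w₀ * (u' : ↥(unitaryGroupOfForm (conjLocal L (IsCMField.complexConj L) v) (cmLocalForm L 3 v))) * w₀⁻¹) := by
  haveI := locallyCompactSpace_cmBorelU L 3 v
  have hσ := conjLocal_conjLocal_cm L v
  have hJ := cmLocalForm_eq_over L 3 v
  have hU := weylElt_mul_unipotent_mul_inv_mem_borelU (conjLocal L (IsCMField.complexConj L) v) hσ hJ w₀ hw₀ u u' b hbu h1 h2
  -- `w₀ u = U · X`
  have hsplit : w₀ * (u : ↥(unitaryGroupOfForm (conjLocal L (IsCMField.complexConj L) v) (cmLocalForm L 3 v))) =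
      ((⟨_, hU⟩ : ↥(cmBorelTriple L 3 v).P) : ↥(unitaryGroupOfForm (conjLocal L (IsCMField.complexConj L) v) (cmLocalForm L 3 v))) *
        (w₀ * (u' : ↥(unitaryGroupOfForm (conjLocal L (IsCMField.complexConj L) v) (cmLocalForm L 3 v))) * w₀⁻¹) := by
    change _ = w₀ * (u : ↥(unitaryGroupOfForm (conjLocal L (IsCMField.complexConj L) v) (cmLocalForm L 3 v))) *
      (w₀ * (u' : ↥(unitaryGroupOfForm (conjLocal L (IsCMField.complexConj L) v) (cmLocalForm L 3 v))) * w₀⁻¹)⁻¹ *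
        (w₀ * (u' : ↥(unitaryGroupOfForm (conjLocal L (IsCMField.complexConj L) v) (cmLocalForm L 3 v))) * w₀⁻¹)
    rw [inv_mul_cancel_right]
  -- the three values on the upper factor: `(proj U)₀₀`, `det (proj U)`, `δ^{1/2}(U)`
  have hval := val_upperFactor_eq (conjLocal L (IsCMField.complexConj L) v) hσ hJ w₀ hw₀ u u' b hbu h1 h2
  have hentry : torusEntry (conjLocal L (IsCMField.complexConj L) v) (cmLocalForm L 3 v) 0 ((cmBorelTriple L 3 v).proj ⟨_, hU⟩) =
      (Units.map (conjLocal L (IsCMField.complexConj L) v : LocalRing L v →* LocalRing L v) b)⁻¹ := by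
    refine Units.ext ?_
    rw [coe_torusEntry_proj_borelTriple, Units.coe_map_inv, MonoidHom.coe_coe]
    change ((w₀ * (u : ↥(unitaryGroupOfForm (conjLocal L (IsCMField.complexConj L) v) (cmLocalForm L 3 v))) *
      (w₀ * (u' : ↥(unitaryGroupOfForm (conjLocal L (IsCMField.complexConj L) v) (cmLocalForm L 3 v))) * w₀⁻¹)⁻¹ :
        ↥(unitaryGroupOfForm (conjLocal L (IsCMField.complexConj L) v) (cmLocalForm L 3 v))) : GL (Fin 3) (LocalRing L v)).val 0 0 = _
    rw [hval]
    rfl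
  have hdet : torusDetNormOne (conjLocal L (IsCMField.complexConj L) v) (cmLocalForm L 3 v) hJ ((cmBorelTriple L 3 v).proj ⟨_, hU⟩) =
      ⟨-1, neg_one_mem_normOneUnits (conjLocal L (IsCMField.complexConj L) v)⟩ := by
    refine Subtype.ext (Units.ext ?_)
    rw [coe_torusDetNormOne, coe_torusDet]
    change ((((cmBorelTriple L 3 v).proj ⟨_, hU⟩ : ↥(torusU (conjLocal L (IsCMField.complexConj L) v) (cmLocalForm L 3 v))) :
        ↥(unitaryGroupOfForm (conjLocal L (IsCMField.complexConj L) v) (cmLocalForm L 3 v))) : GL (Fin 3) (LocalRing L v)).val.det = ((-1 : (LocalRing L v)ˣ) : LocalRing L v)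
    rw [val_proj_borelTriple]
    change (Matrix.diagonal fun i => ((w₀ * (u : ↥(unitaryGroupOfForm (conjLocal L (IsCMField.complexConj L) v) (cmLocalForm L 3 v))) *
      (w₀ * (u' : ↥(unitaryGroupOfForm (conjLocal L (IsCMField.complexConj L) v) (cmLocalForm L 3 v))) * w₀⁻¹)⁻¹ :
        ↥(unitaryGroupOfForm (conjLocal L (IsCMField.complexConj L) v) (cmLocalForm L 3 v))) : GL (Fin 3) (LocalRing L v)).val i i).det = _
    rw [hval, Matrix.det_diagonal, Fin.prod_univ_three, Units.val_neg, Units.val_one]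
    simp only [Matrix.of_apply, Matrix.cons_val', Matrix.cons_val_zero, Matrix.cons_val_one, Matrix.cons_val_two, Matrix.empty_val',
      Matrix.cons_val_fin_one, Matrix.vecHead, Matrix.vecTail, Function.comp_apply, Fin.succ_zero_eq_one]
    have hbbi : (b : LocalRing L v) * ↑b⁻¹ = 1 := b.mul_inv
    have hb' : conjLocal L (IsCMField.complexConj L) v b * conjLocal L (IsCMField.complexConj L) v ↑b⁻¹ = 1 := by rw [← map_mul, hbbi, map_one]
    linear_combination (-(conjLocal L (IsCMField.complexConj L) v b * conjLocal L (IsCMField.complexConj L) v ↑b⁻¹)) * hbbi - hb'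
  have hδ : ((rootDeltaChar (cmBorelTriple L 3 v).P ⟨_, hU⟩ : ℂˣ) : ℂ) = ((((unitModulusChar (LocalRing L v) b)⁻¹ : ℝ≥0) : ℝ) : ℂ) := by
    rw [F0P2oBorelTorusModulus.rootDeltaChar_cmBorel_eq_unitModulusChar L v ⟨_, hU⟩,
      coe_diagEntry_zero_upperFactor (conjLocal L (IsCMField.complexConj L) v) hσ hJ w₀ hw₀ u u' b hbu h1 h2 hU, map_inv]
    borelize (LocalRing L v)
    congr 3
    exact HeisRing.distribHaarChar_map_eq (conjLocal L (IsCMField.complexConj L) v) hσ (continuous_conjLocal L (IsCMField.complexConj L) v) b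
  -- evaluate
  rw [hsplit, f.toFun_subgroup_mul ⟨_, hU⟩, Representation.twist_apply, MonoidHom.comp_apply, Representation.twist_apply,
    Representation.trivial_apply, hδ, smul_smul, smul_eq_mul]
  -- unfold the character pair on the Levi projection
  have hχ : ((cmTorusCharPair L v χ₁ χ₂ ((cmBorelTriple L 3 v).proj ⟨_, hU⟩) : ℂˣ) : ℂ) =
      (((χ₁ (Units.map (conjLocal L (IsCMField.complexConj L) v : LocalRing L v →* LocalRing L v) b))⁻¹ : ℂˣ) : ℂ) *
        ((χ₂ ⟨-1, neg_one_mem_normOneUnits (conjLocal L (IsCMField.complexConj L) v)⟩ : ℂˣ) : ℂ) := by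
    rw [cmTorusCharPair, torusCharPair_apply, hentry, hdet, map_inv, Units.val_mul]
  rw [hχ]
  ring

end CM

end Summit.HodgeConjecture.HodgeConjecture.Cruxes.H413.F0P3cStCharTSBigCellFactorisation

end
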